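import Mathlib
import Literature.Computability.AlgebraicComplexity.SymmetricOrbitCircuit
import HarnessLib

/-!
# The orbit circuit computes its polynomial; square-symmetric circuits of size `|supp| · deg`

Topic `Computability/AlgebraicComplexity`, namespace
`Literature.Computability.AlgebraicComplexity.OrbitCircuit`; companion of
`SymmetricOrbitCircuit.lean` (the construction).

* `eval_cpy`, `eval_mono`, `eval_out` — the copy gate `cpy m pq t` computes `x_pq`, the monomial
  gate `mono m` computes `coeff m · x^m` as soon as `D` bounds the exponents of `m`, and the
  output computes `p` when `D ≥ deg p`.
* `exists_symmetric_circuit_of_invariant` — **every polynomial on the `n × n` matrix invariant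
  under the diagonal action of `Sym(Fin n)` is computed by a square-symmetric
  `LabelledArithCircuit` with `≤ n² + |supp p| · n² · deg p + 2 |supp p| + 1` gates** (the orbit
  circuit; the one-gate constant circuit for `p = 0`).
* `card_support_le_of_totalDegree_le` — a polynomial of total degree `≤ d` in `N` variables has
  `≤ (N + 1)^d` monomials (so polylog degree means quasi-polynomially many monomials).

Everything is proved; folklore.  Consumer: route `MonotoneRestoration` of summit
ValiantsHypothesis (the sparse / polylog-degree regime of its crux `MonotoneRestorationQP`).
-/

noncomputable section

open scoped Classical

namespace Literature.Computability.AlgebraicComplexity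

open MvPolynomial

namespace OrbitCircuit

universe u

variable {n : ℕ}

/-! ### Evaluation of the orbit circuit -/

section Eval

variable {K : Type u} [CommSemiring K] {p : MvPolynomial (Fin n × Fin n) K} {D : ℕ}
  [hp : Fact (∀ σ : Equiv.Perm (Fin n), rename (fun pq : Fin n × Fin n => σ • pq) p = p)]
  (hp0 : p ≠ 0)

open Gate

/-- The number of copies `t < k` among `Fin D` is `k` (for `k ≤ D`). [folklore] -/
theorem card_filter_lt {k : ℕ} (hk : k ≤ D) :
    ((Finset.univ : Finset (Fin D)).filter fun t : Fin D => t.val < k).card = k := by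
  have h : ((Finset.univ : Finset (Fin D)).filter fun t : Fin D => t.val < k).map Fin.valEmbedding =
      Finset.range k := by
    ext x
    simp only [Finset.mem_map, Finset.mem_filter, Finset.mem_univ, true_and, Fin.valEmbedding_apply,
      Finset.mem_range]
    constructor
    · rintro ⟨t, ht, rfl⟩; exact ht
    · intro hx; exact ⟨⟨x, lt_of_lt_of_le hx hk⟩, hx, rfl⟩
  rw [← Finset.card_map, h, Finset.card_range]

/-- `∏_{t < D} (if t < k then a else 1) = a ^ k` for `k ≤ D`. [folklore] -/
theorem prod_ite_lt_eq_pow {R : Type*} [CommMonoid R] (a : R) {k : ℕ} (hk : k ≤ D) :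
    (∏ t : Fin D, if t.val < k then a else 1) = a ^ k := by
  rw [Finset.prod_ite, Finset.prod_const_one, mul_one, Finset.prod_const, card_filter_lt hk]

/-- A copy gate computes its variable. [folklore] -/
theorem eval_cpy (m : p.support) (pq : Fin n × Fin n) (t : Fin D) :
    (orbitCircuit p D hp0).eval (cpy m pq t) = X pq := by
  rw [(orbitCircuit p D hp0).eval_of_label_add (g := cpy m pq t) rfl,
    show (orbitCircuit p D hp0).children (cpy m pq t) = {inp pq} from rfl, Finset.sum_singleton,
    (orbitCircuit p D hp0).eval_of_label_var (g := inp pq) (x := pq) rfl]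

/-- A monomial gate computes its term `coeff m · x^m` (when `D` bounds the exponents).
[folklore] -/
theorem eval_mono (m : p.support) (hD : ∀ pq, m.1 pq ≤ D) :
    (orbitCircuit p D hp0).eval (mono m) = monomial m.1 (p.coeff m.1) := by
  have hnot : cst (coeffOf p m) ∉ copies (D := D) m := fun h => by
    obtain ⟨pq, t, h⟩ := mem_copies h
    cases h
  rw [(orbitCircuit p D hp0).eval_of_label_mul (g := mono m) rfl,
    show (orbitCircuit p D hp0).children (mono m) = insert (cst (coeffOf p m)) (copies m) from rfl,
    Finset.prod_insert hnot,
    (orbitCircuit p D hp0).eval_of_label_const (g := cst (coeffOf p m)) (c := p.coeff m.1) rfl,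
    monomial_eq]
  congr 1
  have hinj : ∀ x ∈ (m.1.support ×ˢ (Finset.univ : Finset (Fin D))).filter
      (fun x => x.2.val < m.1 x.1), ∀ y ∈ (m.1.support ×ˢ (Finset.univ : Finset (Fin D))).filter
      (fun x => x.2.val < m.1 x.1), (cpy m x.1 x.2 : Gate p D) = cpy m y.1 y.2 → x = y := by
    intro x _ y _ h
    simp only [Gate.cpy.injEq, true_and] at h
    exact Prod.ext h.1 h.2
  rw [copies, Finset.prod_image hinj, Finset.prod_filter, Finset.prod_product]
  refine Finset.prod_congr rfl fun pq _ => ?_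
  dsimp only
  simp_rw [eval_cpy hp0]
  exact prod_ite_lt_eq_pow (X pq) (hD pq)

/-- **The orbit circuit computes `p`.** [folklore] -/
theorem eval_out (hD : p.totalDegree ≤ D) : (orbitCircuit p D hp0).eval out = p := by
  rw [(orbitCircuit p D hp0).eval_of_label_add (g := out) rfl,
    show (orbitCircuit p D hp0).children out = Finset.univ.image fun m : p.support => mono m from rfl,
    Finset.sum_image (fun x _ y _ h => by cases h; rfl)]
  have key : ∀ m : p.support, (orbitCircuit p D hp0).eval (mono m) = monomial m.1 (p.coeff m.1) := by
    intro m
    refine eval_mono hp0 m fun pq => ?_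
    have h1 : m.1 pq ≤ m.1.sum fun _ e => e := by
      by_cases hpq : pq ∈ m.1.support
      · exact Finset.single_le_sum (f := fun a => m.1 a) (fun _ _ => Nat.zero_le _) hpq
      · rw [Finsupp.notMem_support_iff.1 hpq]; exact Nat.zero_le _
    exact h1.trans ((le_totalDegree m.2).trans hD)
  simp only [key]
  rw [Finset.sum_coe_sort p.support fun m => monomial m (p.coeff m)]
  exact support_sum_monomial_coeff p

end Eval

/-! ### Existence statements -/

/-- **Every diagonally invariant polynomial on the `n × n` matrix has a square-symmetric circuit
of size `≤ n² + |supp p| · n² · deg p + 2 |supp p| + 1`** (the orbit circuit; for `p = 0` the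
one-gate constant circuit). [folklore] -/
theorem exists_symmetric_circuit_of_invariant {K : Type u} [CommSemiring K]
    (p : MvPolynomial (Fin n × Fin n) K)
    (hp : ∀ σ : Equiv.Perm (Fin n), rename (fun pq : Fin n × Fin n => σ • pq) p = p) :
    ∃ (G : Type u) (_ : Fintype G) (C : LabelledArithCircuit K (Fin n × Fin n) Unit G),
      C.IsSymmetric (Equiv.Perm (Fin n)) ∧ C.eval (C.output ()) = p ∧
      Fintype.card G ≤
        n * n + p.support.card * (n * n * p.totalDegree) + p.support.card + p.support.card + 1 := by
  by_cases hp0 : p = 0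
  · -- the constant circuit `0`
    subst hp0
    let C : LabelledArithCircuit K (Fin n × Fin n) Unit PUnit.{u + 1} :=
      { children := fun _ => ∅
        label := fun _ => .const 0
        output := fun _ => PUnit.unit
        wf := ⟨fun g => ⟨g, fun h hh => by simp at hh⟩⟩
        isInput_iff := fun _ => by simp
        eq_of_label_eq := fun _ _ _ _ => Subsingleton.elim _ _
        output_injective := fun _ _ _ => Subsingleton.elim _ _ }
    refine ⟨PUnit, inferInstance, C, fun γ => ⟨1, ⟨fun _ => by simp [C], fun _ => by simp [C],
      fun _ => rfl⟩⟩, ?_, by simp⟩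
    rw [C.eval_of_label_const (g := PUnit.unit) (c := 0) rfl, C_0]
  · haveI : Fact (∀ σ : Equiv.Perm (Fin n), rename (fun pq : Fin n × Fin n => σ • pq) p = p) := ⟨hp⟩
    refine ⟨OrbitCircuit.Gate p p.totalDegree, inferInstance,
      (orbitCircuit p p.totalDegree hp0).toLabelledArithCircuit,
      (orbitCircuit p p.totalDegree hp0).isSymmetric, eval_out hp0 le_rfl, Gate.card_le⟩

/-! ### Counting monomials of bounded degree -/

/-- The monomials of degree `≤ d` in finitely many variables are covered by a finite set of size
`≤ (#variables + 1)^d`. [folklore] -/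
theorem exists_cover_degree_le {α : Type*} [Fintype α] [DecidableEq α] (d : ℕ) :
    ∃ T : Finset (α →₀ ℕ), (∀ m : α →₀ ℕ, m.degree ≤ d → m ∈ T) ∧
      T.card ≤ (Fintype.card α + 1) ^ d := by
  induction d with
  | zero =>
    refine ⟨{0}, fun m hm => ?_, by simp⟩
    rw [Finset.mem_singleton, ← Finsupp.degree_eq_zero_iff]
    omega
  | succ d ih =>
    obtain ⟨T, hT, hcard⟩ := ih
    refine ⟨T ∪ ((Finset.univ : Finset α) ×ˢ T).image fun x => x.2 + Finsupp.single x.1 1,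
      fun m hm => ?_, ?_⟩
    · rcases Nat.lt_or_ge d m.degree with hlt | hle
      · -- degree `d + 1`: peel off one variable
        have hne : m ≠ 0 := by
          rintro rfl
          simp at hlt
        obtain ⟨a, ha⟩ := Finsupp.support_nonempty_iff.2 hne
        have hle1 : Finsupp.single a 1 ≤ m :=
          Finsupp.single_le_iff.2 (Nat.one_le_iff_ne_zero.2 (Finsupp.mem_support_iff.1 ha))
        have hsplit : m - Finsupp.single a 1 + Finsupp.single a 1 = m := tsub_add_cancel_of_le hle1
        have hdeg : (m - Finsupp.single a 1).degree ≤ d := by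
          have h := congrArg Finsupp.degree hsplit
          rw [map_add, Finsupp.degree_single] at h
          omega
        refine Finset.mem_union_right _ (Finset.mem_image.2 ⟨(a, m - Finsupp.single a 1), ?_, hsplit⟩)
        exact Finset.mem_product.2 ⟨Finset.mem_univ _, hT _ hdeg⟩
      · exact Finset.mem_union_left _ (hT m hle)
    · calc (T ∪ ((Finset.univ : Finset α) ×ˢ T).image fun x => x.2 + Finsupp.single x.1 1).card
          ≤ T.card + (((Finset.univ : Finset α) ×ˢ T).image
              fun x => x.2 + Finsupp.single x.1 1).card := Finset.card_union_le _ _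
        _ ≤ T.card + ((Finset.univ : Finset α) ×ˢ T).card := by
            gcongr; exact Finset.card_image_le
        _ = T.card * (Fintype.card α + 1) := by
            rw [Finset.card_product, Finset.card_univ]; ring
        _ ≤ (Fintype.card α + 1) ^ d * (Fintype.card α + 1) := Nat.mul_le_mul_right _ hcard
        _ = (Fintype.card α + 1) ^ (d + 1) := (pow_succ _ _).symm

/-- **A polynomial of total degree `d` in `N` variables has at most `(N + 1)^d` monomials.**
[folklore] -/
theorem card_support_le_of_totalDegree_le {α : Type*} [Fintype α] [DecidableEq α] {R : Type*}
    [CommSemiring R] (q : MvPolynomial α R) {d : ℕ} (hq : q.totalDegree ≤ d) :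
    q.support.card ≤ (Fintype.card α + 1) ^ d := by
  obtain ⟨T, hT, hcard⟩ := exists_cover_degree_le (α := α) d
  refine le_trans (Finset.card_le_card fun m hm => hT m ?_) hcard
  have : m.degree = m.sum fun _ e => e := by
    simp [Finsupp.degree, Finsupp.sum]
  rw [this]
  exact (le_totalDegree hm).trans hq



end OrbitCircuit

end Literature.Computability.AlgebraicComplexity

end
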